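import Literature.Probability.LatticeModels.DobrushinMetricStates
import HarnessLib

/-!
# Strong-coupling front, gen-14 engine (W1 + W2): the WEIGHTED Dobrushin–Föllmer comparison and covariance estimates —
observatory of the non-perturbative crossover; no mass-gap claim

IR-3 v2 TWO-FRONT CROSSOVER LEDGER, front SC (`β₀`).
ABSOLUTE RULE of this package: No internally-minted statement may enter as a cited fact. Every hypothesis is either
kernel-proved in this package or a verbatim quotation of a PUBLISHED theorem with page reference. The manuscript(s)
under audit are NOT citable for their own disputed steps — they are the thing under adjudication; programme-internal
(2001/route/tribunal) claims are never citable.  Nothing is cited as a hypothesis here: the two theorems below are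
kernel proofs, verbatim twins of `DustingData.iterate_phi_le_pow` ∕ `abs_sub_le_sum_pow_profile`
(`Literature/Probability/LatticeModels/DobrushinComparisonMetric.lean`) and of `abs_covariance_le_of_isKRContraction`
(`DobrushinMetricStates.lean`) with Dobrushin's row condition `∑_y C x y ≤ c` replaced by its WEIGHTED form
`∑_y C x y · v y ≤ c · v x` for a weight `v ≥ vmin > 0` (Dobrushin 1970 §5 / Föllmer 1988 Ch. I Remark (2.17):
the comparison theorem holds for any norm in which `C` is a contraction; here the weighted sup-norm
`‖a‖_v = sup_y |a y| / v y`).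

## What this file is

The ENGINE of the weighted forest door (gen-14 plan W1–W5 of lineage `ir-sc`, `HOME/b2b-balaban-ir-sc-g13/handoff-g13.md`):
* (W1) `iterate_phi_le_pow_weighted` — `(Φⁿ R)_y ≤ R (v y / vmin) c^{min n ℓ(y)}` under the weighted row condition on
  `W`; `abs_sub_le_sum_pow_profile_weighted` — `|E₁ f − E₂ f| ≤ R ∑_{y ∈ Δ} (v y / vmin) c^{ℓ y} δ y` for two invariant
  states;
* (W2) `abs_covariance_le_of_isKRContraction_weighted` — Föllmer's covariance estimate
  `|cov_μ(f, g)| ≤ 2 R² (∑ δ_g) ∑_{y ∈ Δ_f} (v y / vmin) c^{ℓ y} δ_f y` for a Gibbs measure of a specification that is a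
  KR contraction with WEIGHTED rows `≤ c ≤ 1`.
With `v ≡ 1` both are the tree's unweighted theorems.  The point: a forest whose plain Dobrushin rows peak at `15`
(the staggered temporal forests of `StrongCouplingStaggerForest`) can have WEIGHTED rows `≤ ρ v` with `ρ < 15`
(Perron root of the class-transfer table), and the door condition becomes `ρ β_W K₂ < 1`.

NOT CLAIMED: any number of the ledger; nothing here is specific to gauge theories. No mass-gap claim.
-/

noncomputable section

open MeasureTheory ProbabilityTheory Finset Function

namespace Summit.QuantumFields.BalabanUV.InfraRed.StrongCouplingWeightedKREngine

open Literature.Probability.LatticeModels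
open Literature.Probability.LatticeModels.DobrushinMetric

variable {V S : Type*}

/-! ### (W1) The weighted geometric profile of Föllmer's iterates -/

section Profile

variable [DecidableEq V] (D : DustingData V S)

/-- **Weighted geometric profile of the iterates** (twin of `DustingData.iterate_phi_le_pow`): if
`∑_z C y z · v z ≤ c · v y` on `W` for a weight `v ≥ vmin > 0`, `c ∈ [0, 1]`, `ℓ = 0` off `W` and `ℓ x ≤ ℓ y + 1` along
`nbr`, then `(Φⁿ R)_y ≤ R (v y / vmin) c ^ min n (ℓ y)`. [cite: Follmer1988, Ch. I (2.7)] -/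
theorem iterate_phi_le_pow_weighted {c : ℝ} (hc0 : 0 ≤ c) (hc1 : c ≤ 1) {v : V → ℝ} {vmin : ℝ}
    (hvmin : 0 < vmin) (hv : ∀ y, vmin ≤ v y)
    (hrow : ∀ x ∈ D.W, ∑ y ∈ D.nbr x, D.C x y * v y ≤ c * v x) (ℓ : V → ℕ) (hℓW : ∀ y ∉ D.W, ℓ y = 0)
    (hℓ : ∀ x ∈ D.W, ∀ y ∈ D.nbr x, ℓ x ≤ ℓ y + 1) (n : ℕ) (y : V) :
    (D.phi^[n] fun _ => D.R) y ≤ D.R * (v y / vmin) * c ^ min n (ℓ y) := by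
  have hvq : ∀ z, 1 ≤ v z / vmin := fun z => (one_le_div hvmin).2 (hv z)
  have hvq0 : ∀ z, 0 ≤ v z / vmin := fun z => zero_le_one.trans (hvq z)
  induction n generalizing y with
  | zero =>
    simp only [Function.iterate_zero, id_eq, Nat.zero_min, pow_zero, mul_one]
    exact le_mul_of_one_le_right D.R_nonneg (hvq y)
  | succ n ih =>
    rw [Function.iterate_succ_apply']
    by_cases hy : y ∈ D.W
    · rw [D.phi_apply_of_mem hy, DustingData.rowC]
      calc ∑ z ∈ D.nbr y, D.C y z * (D.phi^[n] fun _ => D.R) z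
          ≤ ∑ z ∈ D.nbr y, D.C y z * (D.R * (v z / vmin) * c ^ min n (ℓ y - 1)) := by
            refine Finset.sum_le_sum fun z hz => mul_le_mul_of_nonneg_left ?_ (D.C_nonneg y z)
            refine (ih z).trans (mul_le_mul_of_nonneg_left ?_ (mul_nonneg D.R_nonneg (hvq0 z)))
            refine pow_le_pow_of_le_one hc0 hc1 ?_
            have := hℓ y hy z hz
            omega
        _ = (∑ z ∈ D.nbr y, D.C y z * v z) * (D.R / vmin * c ^ min n (ℓ y - 1)) := by
            rw [Finset.sum_mul]
            exact Finset.sum_congr rfl fun z _ => by ring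
        _ ≤ (c * v y) * (D.R / vmin * c ^ min n (ℓ y - 1)) :=
            mul_le_mul_of_nonneg_right (hrow y hy)
              (mul_nonneg (div_nonneg D.R_nonneg hvmin.le) (pow_nonneg hc0 _))
        _ = D.R * (v y / vmin) * c ^ (min n (ℓ y - 1) + 1) := by ring
        _ ≤ D.R * (v y / vmin) * c ^ min (n + 1) (ℓ y) :=
            mul_le_mul_of_nonneg_left (pow_le_pow_of_le_one hc0 hc1 (by omega))
              (mul_nonneg D.R_nonneg (hvq0 y))
    · rw [D.phi_apply_of_not_mem hy, hℓW y hy]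
      refine (ih y).trans ?_
      rw [hℓW y hy]
      simp

variable {D} {E₁ E₂ : ((V → S) → ℝ) → ℝ}

/-- **Comparison estimate, weighted profile form** (twin of `DustingData.abs_sub_le_sum_pow_profile`): for two
invariant states of the dusting data, under the weighted row condition,
`|E₁ f − E₂ f| ≤ R ∑_{y ∈ Δ} (v y / vmin) · c ^ ℓ y · δ y`. [cite: Follmer1988, Ch. I Comparison Theorem (2.8)] -/
theorem abs_sub_le_sum_pow_profile_weighted (h₁ : D.IsInvariantState E₁) (h₂ : D.IsInvariantState E₂)
    {c : ℝ} (hc0 : 0 ≤ c) (hc1 : c ≤ 1) {v : V → ℝ} {vmin : ℝ} (hvmin : 0 < vmin) (hv : ∀ y, vmin ≤ v y)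
    (hrow : ∀ x ∈ D.W, ∑ y ∈ D.nbr x, D.C x y * v y ≤ c * v x)
    (ℓ : V → ℕ) (hℓW : ∀ y ∉ D.W, ℓ y = 0) (hℓ : ∀ x ∈ D.W, ∀ y ∈ D.nbr x, ℓ x ≤ ℓ y + 1)
    {f : (V → S) → ℝ} {Δ : Finset V} {δ : V → ℝ} (hf : D.P f Δ) (hδ : IsLipBound D.r f δ)
    (hδ0 : ∀ y ∉ Δ, δ y = 0) :
    |E₁ f - E₂ f| ≤ D.R * ∑ y ∈ Δ, v y / vmin * c ^ ℓ y * δ y := by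
  obtain ⟨hest, -⟩ := DustingData.isEstimate_iterate_phi h₁ h₂ (Δ.sup ℓ)
  refine (hest hf hδ hδ0).trans ?_
  rw [Finset.mul_sum]
  refine Finset.sum_le_sum fun y hy => ?_
  have h := iterate_phi_le_pow_weighted D hc0 hc1 hvmin hv hrow ℓ hℓW hℓ (Δ.sup ℓ) y
  rw [min_eq_right (Finset.le_sup hy)] at h
  calc (D.phi^[Δ.sup ℓ] fun _ => D.R) y * δ y ≤ D.R * (v y / vmin) * c ^ ℓ y * δ y :=
        mul_le_mul_of_nonneg_right h (hδ.nonneg y)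
    _ = D.R * (v y / vmin * c ^ ℓ y * δ y) := by ring

end Profile

/-! ### (W2) Föllmer's covariance estimate with weighted rows -/

section Covariance

variable [MeasurableSpace S] {γ : Specification V S} {r : S → S → ℝ} {nbr : V → Finset V} {C : V → V → ℝ}

/-- The weighted rows of the KR dusting data are those of `C`. [cite: Follmer1988, Ch. I (2.20)] -/
theorem sum_krDustingData_C_mul [DecidableEq V] (hγ : IsSpecification γ) (hC : IsKRContraction γ r nbr C)
    {R : ℝ} (hr0 : ∀ a b, 0 ≤ r a b) (hrR : ∀ a b, r a b ≤ R) (hR : 0 ≤ R) (W : Set V) (x : V) (v : V → ℝ) :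
    ∑ y ∈ (krDustingData hγ hC hr0 hrR hR W).nbr x, (krDustingData hγ hC hr0 hrR hR W).C x y * v y =
      ∑ y ∈ nbr x, C x y * v y := by
  change ∑ y ∈ nbr x, (if y ∈ nbr x then C x y else 0) * v y = _
  exact Finset.sum_congr rfl fun y hy => by rw [if_pos hy]

/-- **Covariance estimate in Dobrushin's regime, WEIGHTED Vasserstein form** (twin of
`abs_covariance_le_of_isKRContraction`; Föllmer 1988 Ch. I Thm. (2.13) with Remark (2.17) for the weighted sup-norm):
with `∑_y C x y · v y ≤ c · v x`, `v ≥ vmin > 0`, `c ≤ 1`, a Gibbs measure `μ`, bounded measurable local `f, g` with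
Lipschitz bounds and a profile `ℓ` vanishing on `Δ_g`, `1`-Lipschitz along `nbr` off `Δ_g`:
`|cov_μ(f, g)| ≤ 2 R² (∑_{Δ_g} δ_g) ∑_{y ∈ Δ_f} (v y / vmin) c^{ℓ y} δ_f y`. [cite: Follmer1988, Ch. I Theorem (2.13)] -/
theorem abs_covariance_le_of_isKRContraction_weighted [DecidableEq V] (hγ : IsSpecification γ)
    (hC : IsKRContraction γ r nbr C) {R : ℝ} (hr0 : ∀ a b, 0 ≤ r a b) (hrR : ∀ a b, r a b ≤ R)
    (hR : 0 ≤ R) {c : ℝ} (hc0 : 0 ≤ c) (hc1 : c ≤ 1) {v : V → ℝ} {vmin : ℝ} (hvmin : 0 < vmin)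
    (hv : ∀ y, vmin ≤ v y) (hrow : ∀ x, ∑ y ∈ nbr x, C x y * v y ≤ c * v x)
    {μ : Measure (V → S)} (hμ : IsGibbsMeasure γ μ) {f g : (V → S) → ℝ} (hfm : Measurable f)
    {Δf : Finset V} (hfdep : DependsOn f (↑Δf : Set V)) {Mf : ℝ} (hMf : ∀ σ, |f σ| ≤ Mf)
    {δf : V → ℝ} (hδf : IsLipBound r f δf) (hgm : Measurable g) {Δg : Finset V}
    (hgdep : DependsOn g (↑Δg : Set V)) {Mg : ℝ} (hMg : ∀ σ, |g σ| ≤ Mg) {δg : V → ℝ}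
    (hδg : IsLipBound r g δg) (ℓ : V → ℕ) (hℓ0 : ∀ y ∈ Δg, ℓ y = 0)
    (hℓ : ∀ x ∉ Δg, ∀ y ∈ nbr x, ℓ x ≤ ℓ y + 1) :
    |cov[f, g; μ]| ≤ 2 * R ^ 2 * (∑ y ∈ Δg, δg y) * ∑ y ∈ Δf, v y / vmin * c ^ ℓ y * δf y := by
  haveI := hμ.isProbabilityMeasure
  obtain ⟨τ₀, -⟩ := nonempty_of_measure_ne_zero (μ := μ) (s := Set.univ) (by simp)
  have hvq0 : ∀ z, 0 ≤ v z / vmin := fun z => div_nonneg (hvmin.le.trans (hv z)) hvmin.le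
  set Sg : ℝ := R * ∑ y ∈ Δg, δg y with hSg
  have hSg0 : 0 ≤ Sg := mul_nonneg hR (Finset.sum_nonneg fun y _ => hδg.nonneg y)
  set gt : (V → S) → ℝ := fun σ => g σ + (Sg - g τ₀) with hgt
  have hosc : ∀ σ, |g σ - g τ₀| ≤ Sg := fun σ =>
    abs_sub_le_mul_sum_of_dependsOn hrR hgdep hδg σ τ₀
  have hgt0 : ∀ σ, 0 ≤ gt σ := fun σ => by
    have := (abs_le.1 (hosc σ)).1; simp only [hgt]; linarith
  have hgtB : ∀ σ, gt σ ≤ 2 * Sg := fun σ => by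
    have := (abs_le.1 (hosc σ)).2; simp only [hgt]; linarith
  have hgtm : Measurable gt := hgm.add_const _
  have hgtdep : DependsOn gt (↑Δg : Set V) := fun σ τ h => by
    simp only [hgt]; rw [hgdep h]
  have hgi : Integrable g μ := integrable_of_abs_le' hgm hMg
  have hfi : Integrable f μ := integrable_of_abs_le' hfm hMf
  have hgtabs : ∀ σ, |gt σ| ≤ 2 * Sg := fun σ => by
    rw [abs_of_nonneg (hgt0 σ)]; exact hgtB σ
  have hgti : Integrable gt μ := integrable_of_abs_le' hgtm hgtabs
  have hRHS : 0 ≤ 2 * R ^ 2 * (∑ y ∈ Δg, δg y) * ∑ y ∈ Δf, v y / vmin * c ^ ℓ y * δf y := by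
    have h1 : 0 ≤ ∑ y ∈ Δg, δg y := Finset.sum_nonneg fun y _ => hδg.nonneg y
    have h2 : 0 ≤ ∑ y ∈ Δf, v y / vmin * c ^ ℓ y * δf y :=
      Finset.sum_nonneg fun y _ => mul_nonneg (mul_nonneg (hvq0 y) (pow_nonneg hc0 _)) (hδf.nonneg y)
    positivity
  have hcov : cov[f, g; μ] = ∫ σ, f σ * gt σ ∂μ - (∫ σ, f σ ∂μ) * ∫ σ, gt σ ∂μ := by
    have h1 : cov[f, g; μ] = cov[f, gt; μ] := by
      rw [hgt, covariance_add_const_right hgi]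
    rw [h1, covariance_eq_sub]
    · rfl
    · exact memLp_of_bounded (a := -Mf) (b := Mf)
        (ae_of_all _ fun σ => abs_le.1 (hMf σ)) hfm.aestronglyMeasurable 2
    · exact memLp_of_bounded (a := -(2 * Sg)) (b := 2 * Sg)
        (ae_of_all _ fun σ => abs_le.1 (hgtabs σ)) hgtm.aestronglyMeasurable 2
  by_cases hz : ∫ σ, gt σ ∂μ = 0
  · have hae : gt =ᵐ[μ] 0 := (integral_eq_zero_iff_of_nonneg (fun σ => hgt0 σ) hgti).1 hz
    have hfg : ∫ σ, f σ * gt σ ∂μ = 0 := by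
      rw [← integral_zero (α := V → S) (μ := μ) (G := ℝ)]
      refine integral_congr_ae ?_
      filter_upwards [hae] with σ hσ
      simp [hσ]
    rw [hcov, hfg, hz, mul_zero, sub_zero, abs_zero]
    exact hRHS
  have hpos : 0 < ∫ σ, gt σ ∂μ :=
    lt_of_le_of_ne (integral_nonneg hgt0) (Ne.symm hz)
  let D := krDustingData hγ hC hr0 hrR hR ((↑Δg : Set V)ᶜ)
  have h₁ := isInvariantState_integral_of_isGibbsMeasure hγ hC hr0 hrR hR ((↑Δg : Set V)ᶜ) hμ
  have h₂ := isInvariantState_tilt hγ hC hr0 hrR hR hμ hgtm hgtdep hgt0 hgtB hpos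
  have hδf' := hδf.restrict hfdep
  have key := abs_sub_le_sum_pow_profile_weighted (D := D) h₁ h₂ hc0 hc1 hvmin hv
    (fun x _ => (sum_krDustingData_C_mul hγ hC hr0 hrR hR _ x v).le.trans (hrow x)) ℓ
    (fun y (hy : y ∉ ((↑Δg : Set V)ᶜ)) => hℓ0 y (by simpa using hy))
    (fun x (hx : x ∈ ((↑Δg : Set V)ᶜ)) y hy =>
      hℓ x (fun h' => (Set.mem_compl_iff _ _).1 hx (Finset.mem_coe.2 h')) y hy)
    (f := f) (Δ := Δf) ⟨hfm, hfdep, Mf, hMf⟩ hδf' (fun y hy => if_neg hy)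
  have hsum : ∑ y ∈ Δf, v y / vmin * c ^ ℓ y * (if y ∈ Δf then δf y else 0) =
      ∑ y ∈ Δf, v y / vmin * c ^ ℓ y * δf y :=
    Finset.sum_congr rfl fun y hy => by rw [if_pos hy]
  have key' : |∫ σ, f σ ∂μ - (∫ σ, gt σ * f σ ∂μ) / ∫ σ, gt σ ∂μ| ≤
      R * ∑ y ∈ Δf, v y / vmin * c ^ ℓ y * δf y := by
    rw [← hsum]; exact key
  have hfgt : ∫ σ, f σ * gt σ ∂μ = ∫ σ, gt σ * f σ ∂μ :=
    integral_congr_ae (ae_of_all _ fun σ => mul_comm _ _)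
  have hident : cov[f, g; μ] =
      (∫ σ, gt σ ∂μ) * ((∫ σ, gt σ * f σ ∂μ) / ∫ σ, gt σ ∂μ - ∫ σ, f σ ∂μ) := by
    rw [hcov, hfgt, mul_sub, mul_div_cancel₀ _ hz]
    ring
  rw [hident, abs_mul, abs_of_pos hpos, abs_sub_comm]
  have hgtint : ∫ σ, gt σ ∂μ ≤ 2 * Sg := by
    calc ∫ σ, gt σ ∂μ ≤ ∫ _σ, 2 * Sg ∂μ := integral_mono hgti (integrable_const _) hgtB
      _ = 2 * Sg := by simp
  have h2 : 0 ≤ ∑ y ∈ Δf, v y / vmin * c ^ ℓ y * δf y :=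
    Finset.sum_nonneg fun y _ => mul_nonneg (mul_nonneg (hvq0 y) (pow_nonneg hc0 _)) (hδf.nonneg y)
  calc (∫ σ, gt σ ∂μ) * |∫ σ, f σ ∂μ - (∫ σ, gt σ * f σ ∂μ) / ∫ σ, gt σ ∂μ|
      ≤ (2 * Sg) * (R * ∑ y ∈ Δf, v y / vmin * c ^ ℓ y * δf y) :=
        mul_le_mul hgtint key' (abs_nonneg _) (by positivity)
    _ = 2 * R ^ 2 * (∑ y ∈ Δg, δg y) * ∑ y ∈ Δf, v y / vmin * c ^ ℓ y * δf y := by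
        rw [hSg]; ring

end Covariance

end Summit.QuantumFields.BalabanUV.InfraRed.StrongCouplingWeightedKREngine
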